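import Literature.AnabelianGeometry.EtaleTheta.Discharge.Sec2MonodromyModelTowerMembers
import HarnessLib

/-!
# The MONODROMY TOY with the LOOP-cut `(1, l-tors)` covering, part 1 (DEF-BEARING): coordinate subgroups of the finite
# shadow `heisPiC l = (ℤ/l × ℤ/l) ⋊ D_l` — `heisV = (ℤ/l)² ⋊ 1`, `heisVS = (ℤ/l)² ⋊ {1, s}`, the `b`-axis, `b`-axis `⋊ {1, s}`

S. Mochizuki, *The étale theta function and its Frobenioid-theoretic manifestations* [EtTh], Publ. RIMS **45**
(2009), §2 Def. 2.1 p. 36, Prop. 2.2 (i) p. 37, Def. 2.3 p. 38 (PRIMS text pages) [cite: MochizukiEtTh2009, Def 2.1 p.36].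
Cell `abc-iut`, F lane (F-0640/F-0641 follow-up «CΘ-FAITHFUL TOY»), seat abc-iut-f-128 (gen 14); abc-iut-L2-lead custody
(R1504/R1515 rails, count-neutral).  These are the shadows, in abc-iut-w5-d243's finite Heisenberg witness, of the
subgroups `Π_{X̲} ⊂ Π_{C̲}` and `Δ_{X̲̲} ⊂ Π_{C̲̲}` of part 2 (`ThetaCoversMonodromyModelLoop.lean`), where Def. 2.1's quotient
`Q` is realised by the LOOP INDEX (the `D_l`-component) rather than by the coordinate `b` (abc-iut-w6-d084's choice):
`heisVS ∩ heisPiX = heisV` (index 2), `b-axis · Δ̄_Θ = heisV`, `(b-axis ⋊ {1,s}) · Δ̄_Θ = heisVS`, `s` inverts the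
`b`-axis and fixes `Δ̄_Θ`.
HONEST LABEL (abc-iut-L2-lead R1352, verbatim, inherited from the carrier): «a DESIGNED tempered toy with print's monodromy
combinatorics — loop ↦ `Δ̄^ell` (`b`-cycle), the inversion INVERTS it, unipotent monodromy `x ↦ x·z` on the `a`-cycle,
`z` = cusp inertia = `Δ̄_Θ` central; `G_K := 1`; NOT a Tate curve, NOT the tempered fundamental group of a curve;
consistency ≠ faithfulness; nothing here takes a side on anything printed.»  DEF-BEARING (4 subgroups; 0 `instance`, 0
notation; nothing frozen is edited).  No bearing on [IUTchIII] Cor. 3.12; no side taken; typed ≠ proved.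
-/

noncomputable section

namespace Literature.AnabelianGeometry.EtaleTheta.ThetaCovers.MonodromyModel

open Multiplicative HeisenbergWitness TemperedModel DihedralGroup

variable (l : ℕ)

/-! ## 1. Coordinate subgroups of the finite shadow `heisPiC l = (ℤ/l × ℤ/l) ⋊ D_l` -/

/-- `heisV := (ℤ/l × ℤ/l) ⋊ 1 = Ker(rotation/reflection part)` — the shadow of `Π_{X̲}` cut by the LOOP INDEX.
(toy bookkeeping for the typed interface of [EtTh] Def. 2.1; no claim about print) [cite: MochizukiEtTh2009, Def 2.1 p.36] -/
def heisV : Subgroup (heisPiC l) := (SemidirectProduct.rightHom : heisPiC l →* DihedralGroup l).ker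

/-- Membership in `heisV`: `d = 1`. (toy bookkeeping) [cite: MochizukiEtTh2009, Def 2.1 p.36] -/
theorem mem_heisV {x : heisPiC l} : x ∈ heisV l ↔ x.right = 1 := MonoidHom.mem_ker

/-- `heisVS := (ℤ/l × ℤ/l) ⋊ {1, s}` — the shadow of `Π_{C̲}`. (toy bookkeeping for the typed interface of [EtTh] Def. 2.1;
no claim about print) [cite: MochizukiEtTh2009, Def 2.1 p.36] -/
def heisVS : Subgroup (heisPiC l) where
  carrier := {x | x.right = 1 ∨ x.right = sr 0}
  mul_mem' {x y} hx hy := by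
    simp only [Set.mem_setOf_eq, SemidirectProduct.mul_right] at hx hy ⊢
    rcases hx with hx | hx <;> rcases hy with hy | hy <;> simp [hx, hy]
  one_mem' := Or.inl rfl
  inv_mem' {x} hx := by
    simp only [Set.mem_setOf_eq, SemidirectProduct.inv_right] at hx ⊢
    rcases hx with hx | hx <;> simp [hx]

/-- Membership in `heisVS`: `d ∈ {1, s}`. (toy bookkeeping) [cite: MochizukiEtTh2009, Def 2.1 p.36] -/
theorem mem_heisVS {x : heisPiC l} : x ∈ heisVS l ↔ x.right = 1 ∨ x.right = sr 0 := Iff.rfl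

/-- `heisBax := {(b, 0)} ⋊ 1`, the `b`-axis — the shadow of `Δ_{X̲̲} = Im(s_ι)` (the `(−1)`-eigenspace of `ι`).
(toy bookkeeping for the typed interface of [EtTh] Prop. 2.2 (i); no claim about print) [cite: MochizukiEtTh2009, Prop 2.2 p.37] -/
def heisBax : Subgroup (heisPiC l) where
  carrier := {x | x.right = 1 ∧ γ l x = 0}
  mul_mem' {x y} hx hy := by
    simp only [Set.mem_setOf_eq] at hx hy ⊢
    refine ⟨by rw [SemidirectProduct.mul_right, hx.1, hy.1, mul_one], ?_⟩
    rw [γ_mul, hx.1, hx.2, hy.2, rotIdx_one, zero_mul, add_zero, add_zero]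
  one_mem' := ⟨rfl, γ_one l⟩
  inv_mem' {x} hx := by
    simp only [Set.mem_setOf_eq] at hx ⊢
    refine ⟨by rw [SemidirectProduct.inv_right, hx.1, inv_one], ?_⟩
    rw [γ_inv, hx.1, hx.2, inv_one, rotIdx_one, zero_mul, neg_zero, sub_zero]

/-- Membership in `heisBax`: `d = 1`, `c = 0`. (toy bookkeeping) [cite: MochizukiEtTh2009, Prop 2.2 p.37] -/
theorem mem_heisBax {x : heisPiC l} : x ∈ heisBax l ↔ x.right = 1 ∧ γ l x = 0 := Iff.rfl

/-- `heisBS := {(b, 0)} ⋊ {1, s}` — the shadow of `Π_{C̲̲}`. (toy bookkeeping for the typed interface of [EtTh] Def. 2.3;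
no claim about print) [cite: MochizukiEtTh2009, Def 2.3 p.38] -/
def heisBS : Subgroup (heisPiC l) where
  carrier := {x | (x.right = 1 ∨ x.right = sr 0) ∧ γ l x = 0}
  mul_mem' {x y} hx hy := by
    simp only [Set.mem_setOf_eq] at hx hy ⊢
    refine ⟨(heisVS l).mul_mem (show x ∈ heisVS l from hx.1) (show y ∈ heisVS l from hy.1), ?_⟩
    rw [γ_mul, hx.2, hy.2]
    rcases hx.1 with h | h <;> simp [h]
  one_mem' := ⟨Or.inl rfl, γ_one l⟩
  inv_mem' {x} hx := by
    simp only [Set.mem_setOf_eq] at hx ⊢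
    refine ⟨(heisVS l).inv_mem (show x ∈ heisVS l from hx.1), ?_⟩
    rw [γ_inv, hx.2]
    rcases hx.1 with h | h <;> simp [h]

/-- Membership in `heisBS`. (toy bookkeeping) [cite: MochizukiEtTh2009, Def 2.3 p.38] -/
theorem mem_heisBS {x : heisPiC l} : x ∈ heisBS l ↔ (x.right = 1 ∨ x.right = sr 0) ∧ γ l x = 0 := Iff.rfl

/-- `heisVS ∩ heisPiX = heisV` (`s` is not a rotation). (toy bookkeeping) [cite: MochizukiEtTh2009, Def 2.1 p.36] -/
theorem heisVS_inf_heisPiX : heisVS l ⊓ heisPiX l = heisV l := by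
  ext x
  rw [Subgroup.mem_inf, mem_heisVS, mem_heisPiX, mem_heisV]
  constructor
  · rintro ⟨h | h, ⟨i, hi⟩⟩
    · exact h
    · rw [h] at hi; cases hi
  · intro h
    exact ⟨Or.inl h, ⟨0, by rw [h, one_def]⟩⟩

/-- `heisBS ∩ heisPiX = heisBax`. (toy bookkeeping) [cite: MochizukiEtTh2009, Def 2.3 p.38] -/
theorem heisBS_inf_heisPiX : heisBS l ⊓ heisPiX l = heisBax l := by
  ext x
  rw [Subgroup.mem_inf, mem_heisBS, mem_heisPiX, mem_heisBax]
  constructor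
  · rintro ⟨⟨h | h, hc⟩, ⟨i, hi⟩⟩
    · exact ⟨h, hc⟩
    · rw [h] at hi; cases hi
  · rintro ⟨h, hc⟩
    exact ⟨⟨Or.inl h, hc⟩, ⟨0, by rw [h, one_def]⟩⟩

/-- `heisTheta ≤ heisV`, `heisBax ≤ heisV`, `heisV ≤ heisVS`, `heisBax ≤ heisBS ≤ heisVS`. (toy bookkeeping)
[cite: MochizukiEtTh2009, Def 2.1 p.36] -/
theorem heis_le : heisTheta l ≤ heisV l ∧ heisBax l ≤ heisV l ∧ heisV l ≤ heisVS l ∧ heisBax l ≤ heisBS l ∧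
    heisBS l ≤ heisVS l ∧ heisV l ≤ heisPiX l :=
  ⟨fun _ hx => ((mem_heisTheta l).mp hx).1, fun _ hx => hx.1, fun _ hx => Or.inl hx, fun _ hx => ⟨Or.inl hx.1, hx.2⟩,
    fun _ hx => hx.1, fun _ hx => (mem_heisPiX l).mpr ⟨0, by rw [(mem_heisV l).mp hx, one_def]⟩⟩

/-- `heisBax · heisTheta = heisV`: `((b, c), 1) = ((b, 0), 1) · ((0, c), 1)`. (toy bookkeeping for [EtTh] Prop. 2.2 (i)
«`Δ̄_{X̲} = Δ̄^ell × Δ̄_Θ`»; no claim about print) [cite: MochizukiEtTh2009, Prop 2.2 p.37] -/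
theorem heisBax_sup_heisTheta : heisBax l ⊔ heisTheta l = heisV l := by
  haveI := heisTheta_normal l
  refine le_antisymm (sup_le (heis_le l).2.1 (heis_le l).1) fun x hx => ?_
  rw [mem_heisV] at hx
  rw [Subgroup.mem_sup_of_normal_right]
  refine ⟨SemidirectProduct.inl (ofAdd (β l x, 0)), ⟨rfl, by simp [γ]⟩, SemidirectProduct.inl (ofAdd (0, γ l x)),
    (mem_heisTheta l).mpr ⟨rfl, by simp [β]⟩, ?_⟩
  refine ext_of_coords l ?_ ?_ ?_
  · rw [SemidirectProduct.mul_right, SemidirectProduct.right_inl, SemidirectProduct.right_inl, hx, mul_one]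
  · simp [β]
  · simp [β, γ]

/-- `heisBS · heisTheta = heisVS`. (toy bookkeeping) [cite: MochizukiEtTh2009, Def 2.3 p.38] -/
theorem heisBS_sup_heisTheta : heisBS l ⊔ heisTheta l = heisVS l := by
  haveI := heisTheta_normal l
  refine le_antisymm (sup_le (heis_le l).2.2.2.2.1 ((heis_le l).1.trans (heis_le l).2.2.1)) fun x hx => ?_
  rw [Subgroup.mem_sup_of_normal_right]
  -- `x = (x · ((0, -c), 1)) · ((0, c), 1)` with `c = γ x`; the first factor has `γ = 0`
  refine ⟨x * SemidirectProduct.inl (ofAdd (0, -γ l x)), ⟨?_, ?_⟩, SemidirectProduct.inl (ofAdd (0, γ l x)),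
    (mem_heisTheta l).mpr ⟨rfl, by simp [β]⟩, ?_⟩
  · rw [SemidirectProduct.mul_right, SemidirectProduct.right_inl, mul_one]; exact hx
  · rcases (mem_heisVS l).mp hx with h | h <;> simp [γ, h]
  · rw [mul_assoc, ← map_mul, ← ofAdd_add, Prod.mk_add_mk, add_zero, neg_add_cancel, Prod.mk_zero_zero, ofAdd_zero,
      map_one, mul_one]

/-- `[heisVS : heisV] = 2`. (toy bookkeeping for [EtTh] Def. 2.1 «`[Π_{C̲} : Π_{X̲}] = 2`»; no claim about print)
[cite: MochizukiEtTh2009, Def 2.1 p.36] -/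
theorem relIndex_heisVS_inf : (heisVS l ⊓ heisPiX l).relIndex (heisVS l) = 2 := by
  haveI : (heisPiX l).Normal := MonoidHom.normal_ker _
  rw [Subgroup.inf_relIndex_left]
  have hdvd : (heisPiX l).relIndex (heisVS l) ∣ 2 := index_heisPiX l ▸ Subgroup.relIndex_dvd_index_of_normal _ _
  rcases (Nat.dvd_prime Nat.prime_two).mp hdvd with h1 | h2
  · exfalso
    rw [Subgroup.relIndex_eq_one] at h1
    exact inr_sr_not_mem_heisPiX l 0 (h1 ((mem_heisVS l).mpr (Or.inr rfl)))
  · exact h2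

/-- `s` normalises `heisBax` (`s·(b, 0) = (−b, 0)`). (toy bookkeeping) [cite: MochizukiEtTh2009, Prop 2.2 p.37] -/
theorem sr_conj_mem_heisBax {e : heisPiC l} (he : e ∈ heisBax l) :
    SemidirectProduct.inr (sr 0) * e * (SemidirectProduct.inr (sr 0))⁻¹ ∈ heisBax l := by
  obtain ⟨h1, h2⟩ := (mem_heisBax l).mp he
  refine (mem_heisBax l).mpr ⟨?_, ?_⟩
  · simp [h1]
  · simp [h1, h2]

/-- `s e s⁻¹ e = 1` for `e` on the `b`-axis (`ι` acts by `−1`). (toy bookkeeping) [cite: MochizukiEtTh2009, Prop 2.2 p.37] -/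
theorem sr_conj_mul_self_heisBax {e : heisPiC l} (he : e ∈ heisBax l) :
    SemidirectProduct.inr (sr 0) * e * (SemidirectProduct.inr (sr 0))⁻¹ * e = 1 := by
  obtain ⟨h1, h2⟩ := (mem_heisBax l).mp he
  refine eq_one_of_coords l ?_ ?_ ?_
  · simp [h1]
  · simp [h1]
  · simp [h1, h2]

/-- `heisV` normalises `heisBax` (it is abelian). (toy bookkeeping) [cite: MochizukiEtTh2009, Prop 2.2 p.37] -/
theorem conj_mem_heisBax {g e : heisPiC l} (hg : g ∈ heisV l) (he : e ∈ heisBax l) : g * e * g⁻¹ ∈ heisBax l := by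
  rw [mem_heisV] at hg
  obtain ⟨h1, h2⟩ := (mem_heisBax l).mp he
  refine (mem_heisBax l).mpr ⟨?_, ?_⟩
  · rw [SemidirectProduct.mul_right, SemidirectProduct.mul_right, SemidirectProduct.inv_right, hg, h1, one_mul,
      one_mul, inv_one]
  · simp [hg, h1, h2]

/-- `heisBax ∩ heisTheta = 1`. (toy bookkeeping) [cite: MochizukiEtTh2009, Prop 2.2 p.37] -/
theorem heisBax_inf_heisTheta : heisBax l ⊓ heisTheta l = ⊥ := by
  rw [eq_bot_iff]
  rintro x ⟨hB, hT⟩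
  rw [Subgroup.mem_bot]
  exact eq_one_of_coords l hB.1 ((mem_heisTheta l).mp hT).2 hB.2

end Literature.AnabelianGeometry.EtaleTheta.ThetaCovers.MonodromyModel

end
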